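import Mathlib
import Literature.Analysis.FluidPDE.Tao2016AveragedNS.RenormalisedCascadeWaves
import Literature.Analysis.FluidPDE.Tao2016AveragedNS.SelfSimilarCascadeBlowup

/-!
# The table class `E₂(R)` BELOW THE DYADIC SPREAD `R < 2` has no square monomials
# (structural remark for the cruxes of route TaoLadderRungTwoBreak quantifying over `∀ R ≥ 1, … InTableClass R …`;
# `--supports stmt-NavierStokesRegularity-20419`)

MODEL lattice (Tao 2016 §4) only; nothing here is a statement about the Navier–Stokes equations; no stub, crux, rung
or summit is proved.  Pure algebra of the structure constants (symmetry (4.2), cancellation (4.3), `R`-comparability).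

For a symmetric cancelling table `α` and any modes `a, b`, the cancellation sum (4.3) at the index triple `(b,b,a)`
collapses (two pairs of its six terms coincide by (4.2)) to

  `α_{bba,(0,0,1)} = −2 α_{abb,(1,0,0)}`  and  `α_{bba,(0,0,0)} = −2 α_{abb,(0,0,0)}`      (`outflowSq_eq`, `rotorSq_eq`)

— the outflow coefficient of the square monomial `x_b² ↦` (mode `a` of the shell above) is minus twice its back-reaction
coefficient, and likewise for the intra-shell square monomial.  On an `R`-comparable table (non-zero moduli in `[R⁻¹, 1]`)
with `R < 2` both sides must therefore VANISH (`sqCoeff_eq_zero_of_lt_two`): below the dyadic spread a table couples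
only three DISTINCT modes, a one-mode shell state has zero outflow and zero self-interaction (`tableA_eq_zero_of_oneMode`,
`tableQ_eq_zero_of_oneMode`), and the dyadic member (entries `1, −1/2, −1/2`) enters the class EXACTLY at `R = 2`
(`inTableClass_dyadicTable_iff`; the tree had the direction `2 ≤ R →`).  READING for the census of ⟨20419⟩/⟨20420⟩/⟨20205⟩:
the Katz–Pavlović phenomenology (square self-feeding `x² ↦ y`) of every landed dyadic rung lives in `E₂(R)`, `R ≥ 2`, only;
the corner `1 ≤ R < 2` of «`∀ R ≥ 1`» is a genuinely multi-mode (rotor-type) class — not vacuous (e.g. the `{0,±1}`-valued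
table `α_{123,(001)} = α_{213,(001)} = 1`, `α_{312,(100)} = α_{132,(010)} = −1` is symmetric, cancelling and has outflow
`A(x)₃ = 2x₁x₂`: `exists_live_inTableClass_one`).  HONEST LABEL: bookkeeping; every stub of the three items remains OPEN.
-/

noncomputable section

-- the summit and its single sub-problem share the name (CONVENTIONS §1)
set_option linter.dupNamespace false

namespace Summit.NavierStokesRegularity.NavierStokesRegularity.Theorems.NoSurvivingEternalViscBddOne.SubDyadicSpread

open Literature.Analysis.FluidPDE Literature.Analysis.FluidPDE.TaoCascade

variable {m : ℕ} {R : ℝ} {α : Fin m → Fin m → Fin m → ℤ × ℤ × ℤ → ℝ}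

/-- **Square outflow vs. its back-reaction.**  On a symmetric cancelling table, for all modes `a, b`:
`α_{bba,(0,0,1)} = −2·α_{abb,(1,0,0)}` — (4.3) at the index triple `(b,b,a)`, shift `(0,0,1)`, where (4.2) identifies
`α_{bab,(0,1,0)} = α_{abb,(1,0,0)}`.  (Dyadic member: `1 = −2·(−1/2)`.)
[cite: Tao2016AveragedNS, §4 (4.2)–(4.3)] -/
theorem outflowSq_eq (hs : IsSymmetricCoeff α) (hc : IsCancellingCoeff α) (a b : Fin m) :
    α b b a (0, 0, 1) = -2 * α a b b (1, 0, 0) := by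
  have h1 := hc b b a 0 0 1 (by rw [mem_shiftSet_iff]; simp)
  have h2 : α b a b (0, 1, 0) = α a b b (1, 0, 0) := hs b a b 0 1 0 (by rw [mem_shiftSet_iff]; simp)
  rw [h2] at h1
  linarith

/-- The symmetric partner: `α_{bab,(0,1,0)} = α_{abb,(1,0,0)}`. [cite: Tao2016AveragedNS, §4 (4.2)] -/
theorem backSq_eq (hs : IsSymmetricCoeff α) (a b : Fin m) :
    α b a b (0, 1, 0) = α a b b (1, 0, 0) :=
  hs b a b 0 1 0 (by rw [mem_shiftSet_iff]; simp)

/-- **Intra-shell square monomial.**  On a symmetric cancelling table, for all modes `a, b`: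
`α_{bba,(0,0,0)} = −2·α_{abb,(0,0,0)}` ((4.3) at `(b,b,a)`, shift `(0,0,0)`, with (4.2)).
[cite: Tao2016AveragedNS, §4 (4.2)–(4.3)] -/
theorem rotorSq_eq (hs : IsSymmetricCoeff α) (hc : IsCancellingCoeff α) (a b : Fin m) :
    α b b a (0, 0, 0) = -2 * α a b b (0, 0, 0) := by
  have h1 := hc b b a 0 0 0 (by rw [mem_shiftSet_iff]; simp)
  have h2 : α b a b (0, 0, 0) = α a b b (0, 0, 0) := hs b a b 0 0 0 (by rw [mem_shiftSet_iff]; simp)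
  rw [h2] at h1
  linarith

/-- Elementary: if `|u| ≤ 1`, `u = -2 v` and `v = 0 ∨ R⁻¹ ≤ |v|` with `0 < R < 2`, then `v = 0` (hence `u = 0`). [elementary] -/
theorem eq_zero_of_comparable {u v : ℝ} (hR0 : 0 < R) (hR : R < 2) (hu : |u| ≤ 1) (huv : u = -2 * v)
    (hv : v = 0 ∨ R⁻¹ ≤ |v|) : v = 0 := by
  rcases hv with hv | hv
  · exact hv
  · exfalso
    have h1 : |u| = 2 * |v| := by
      rw [huv, abs_mul, abs_neg, abs_two]
    have h2 : (1 : ℝ) < 2 * R⁻¹ := by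
      rw [← div_eq_mul_inv, lt_div_iff₀ hR0]; linarith
    have h3 : 2 * R⁻¹ ≤ |u| := by rw [h1]; linarith
    linarith

/-- **NO SQUARE MONOMIALS BELOW THE DYADIC SPREAD.**  On a table of `E₂(R)` with `0 < R < 2`, for all modes `a, b`:
the square outflow `α_{bba,(0,0,1)}`, its two back-reaction partners `α_{abb,(1,0,0)}`, `α_{bab,(0,1,0)}`, and the
intra-shell square coefficients `α_{bba,(0,0,0)}`, `α_{abb,(0,0,0)}`, `α_{bab,(0,0,0)}` all vanish
(a non-zero back-reaction coefficient `≥ R⁻¹ > 1/2` would force a square coefficient of modulus `> 1`).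
[cite: Tao2016AveragedNS, §4 (4.2)–(4.3), §6.1; cell vocabulary `InTableClass`] -/
theorem sqCoeff_eq_zero_of_lt_two (hα : InTableClass R α) (hR0 : 0 < R) (hR : R < 2) (a b : Fin m) :
    α b b a (0, 0, 1) = 0 ∧ α a b b (1, 0, 0) = 0 ∧ α b a b (0, 1, 0) = 0 ∧
      α b b a (0, 0, 0) = 0 ∧ α a b b (0, 0, 0) = 0 ∧ α b a b (0, 0, 0) = 0 := by
  obtain ⟨hs, hc, hcomp⟩ := hα
  have e1 := outflowSq_eq hs hc a b
  have e2 := backSq_eq hs a b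
  have e3 := rotorSq_eq hs hc a b
  have e4 : α b a b (0, 0, 0) = α a b b (0, 0, 0) := hs b a b 0 0 0 (by rw [mem_shiftSet_iff]; simp)
  have hv1 : α a b b (1, 0, 0) = 0 :=
    eq_zero_of_comparable hR0 hR (hcomp b b a ((0 : ℤ), (0 : ℤ), (1 : ℤ)) (by rw [mem_shiftSet_iff]; simp)).1 e1
      (hcomp a b b ((1 : ℤ), (0 : ℤ), (0 : ℤ)) (by rw [mem_shiftSet_iff]; simp)).2
  have hv2 : α a b b (0, 0, 0) = 0 :=
    eq_zero_of_comparable hR0 hR (hcomp b b a ((0 : ℤ), (0 : ℤ), (0 : ℤ)) (by rw [mem_shiftSet_iff]; simp)).1 e3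
      (hcomp a b b ((0 : ℤ), (0 : ℤ), (0 : ℤ)) (by rw [mem_shiftSet_iff]; simp)).2
  refine ⟨?_, hv1, ?_, ?_, hv2, ?_⟩
  · rw [e1, hv1, mul_zero]
  · rw [e2, hv1]
  · rw [e3, hv2, mul_zero]
  · rw [e4, hv2]

/-- The coordinate form of a table at shift `μ` on a ONE-MODE pair `(x, x)`, `x` supported on mode `b`, is
`α_{bb i,μ}·x_b²`. [cite: Tao2016AveragedNS, §4 (4.1), Lemma 4.1 (4.8); cell vocabulary `qform`] -/
theorem qform_oneMode (α : Fin m → Fin m → Fin m → ℤ × ℤ × ℤ → ℝ) (μ : ℤ × ℤ × ℤ) {x : Em m} {b : Fin m}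
    (hx : ∀ j, j ≠ b → x j = 0) (i : Fin m) :
    qform α μ x x i = α b b i μ * (x b * x b) := by
  unfold qform
  rw [Finset.sum_eq_single b]
  · rw [Finset.sum_eq_single b]
    · intro i₂ _ hi₂; rw [hx i₂ hi₂]; ring
    · intro h; exact absurd (Finset.mem_univ b) h
  · intro i₁ _ hi₁
    exact Finset.sum_eq_zero fun i₂ _ => by rw [hx i₁ hi₁]; ring
  · intro h; exact absurd (Finset.mem_univ b) h

/-- **A one-mode shell state has NO OUTFLOW below the dyadic spread**: on a table of `E₂(R)`, `0 < R < 2`, if `x` is supported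
on a single mode then `A(x) = 0` — such a shell feeds nothing to the shell above.
[cite: Tao2016AveragedNS, §4 (4.1)–(4.3), Lemma 4.1 (4.8); cell vocabulary `tableA`, `InTableClass`] -/
theorem tableA_eq_zero_of_oneMode (hα : InTableClass R α) (hR0 : 0 < R) (hR : R < 2) {x : Em m} {b : Fin m}
    (hx : ∀ j, j ≠ b → x j = 0) : tableA α x = 0 := by
  unfold tableA
  refine Finset.sum_eq_zero fun i _ => ?_
  rw [qform_oneMode α _ hx i, (sqCoeff_eq_zero_of_lt_two hα hR0 hR i b).1, zero_mul, zero_smul]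

/-- **A one-mode shell state has NO SELF-INTERACTION below the dyadic spread**: on a table of `E₂(R)`, `0 < R < 2`, if `x` is
supported on a single mode then `Q(x) = 0`.
[cite: Tao2016AveragedNS, §4 (4.1)–(4.3), Lemma 4.1 (4.8); cell vocabulary `tableQ`, `InTableClass`] -/
theorem tableQ_eq_zero_of_oneMode (hα : InTableClass R α) (hR0 : 0 < R) (hR : R < 2) {x : Em m} {b : Fin m}
    (hx : ∀ j, j ≠ b → x j = 0) : tableQ α x = 0 := by
  unfold tableQ
  refine Finset.sum_eq_zero fun i _ => ?_
  rw [qform_oneMode α _ hx i, (sqCoeff_eq_zero_of_lt_two hα hR0 hR i b).2.2.2.1, zero_mul, zero_smul]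

/-- **The dyadic member is NOT in `E₂(R)` for `R < 2`** (its outflow coefficient `α_{000,(0,0,1)} = 1` is a square monomial).
[cite: Tao2016AveragedNS, §1.2, §4 (4.2)–(4.3); cell vocabulary `dyadicTable`, `InTableClass`] -/
theorem not_inTableClass_dyadicTable_of_lt_two (hR0 : 0 < R) (hR : R < 2) : ¬ InTableClass R dyadicTable := by
  intro h
  have h1 := (sqCoeff_eq_zero_of_lt_two h hR0 hR (0 : Fin 4) (0 : Fin 4)).1
  have h2 : dyadicTable 0 0 0 ((0 : ℤ), (0 : ℤ), (1 : ℤ)) = 1 := by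
    unfold dyadicTable; simp
  rw [h2] at h1
  exact one_ne_zero h1

/-- **The dyadic member enters the comparable class EXACTLY at the dyadic spread**: for `R > 0`,
`dyadicTable ∈ E₂(R) ↔ 2 ≤ R` (tree: `inTableClass_dyadicTable` is `←`).
[cite: Tao2016AveragedNS, §1.2, §4 (4.2)–(4.3), §6.1; cell vocabulary] -/
theorem inTableClass_dyadicTable_iff (hR0 : 0 < R) : InTableClass R dyadicTable ↔ 2 ≤ R := by
  constructor
  · intro h
    by_contra hlt
    exact not_inTableClass_dyadicTable_of_lt_two hR0 (not_le.1 hlt) h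
  · exact inTableClass_dyadicTable

/-- **`E₂(1)` IS LIVE** — the corner `R = 1` of «`∀ R ≥ 1`» is not vacuous: the `{0,±1}`-valued table with
`α_{123,(0,0,1)} = α_{213,(0,0,1)} = 1` (outflow `A(x)₃ = 2x₁x₂` to the shell above) and `α_{312,(1,0,0)} = α_{132,(0,1,0)} = −1`
(back-reaction `B(y,x)₂ = −2x₁y₃`), all other constants `0`, is symmetric (4.2), cancelling (4.3) and `1`-comparable, i.e. lies
in `InTableClass 1`, and its outflow coefficient `α_{123,(0,0,1)} = 1` is non-zero.  (A genuinely THREE-mode coupling, as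
`sqCoeff_eq_zero_of_lt_two` forces below the dyadic spread.)
[cite: Tao2016AveragedNS, §4 (4.1)–(4.3), §6.1; cell vocabulary `InTableClass`] -/
theorem exists_live_inTableClass_one :
    ∃ α : Fin 4 → Fin 4 → Fin 4 → ℤ × ℤ × ℤ → ℝ, InTableClass 1 α ∧ α 1 2 3 (0, 0, 1) = 1 := by
  refine ⟨fun i₁ i₂ i₃ μ =>
    if i₃ = 3 ∧ ((i₁ = 1 ∧ i₂ = 2) ∨ (i₁ = 2 ∧ i₂ = 1)) ∧ μ = ((0 : ℤ), (0 : ℤ), (1 : ℤ)) then 1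
    else if i₁ = 3 ∧ i₂ = 1 ∧ i₃ = 2 ∧ μ = ((1 : ℤ), (0 : ℤ), (0 : ℤ)) then -1
    else if i₁ = 1 ∧ i₂ = 3 ∧ i₃ = 2 ∧ μ = ((0 : ℤ), (1 : ℤ), (0 : ℤ)) then -1
    else 0, ⟨?_, ?_, ?_⟩, ?_⟩
  · -- symmetry (4.2): 4 shifts × 64 index triples
    intro i₁ i₂ i₃ μ₁ μ₂ μ₃ hμ
    rw [mem_shiftSet_iff] at hμ
    simp only [Prod.mk.injEq] at hμ
    rcases hμ with ⟨rfl, rfl, rfl⟩ | ⟨rfl, rfl, rfl⟩ | ⟨rfl, rfl, rfl⟩ | ⟨rfl, rfl, rfl⟩ <;>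
      fin_cases i₁ <;> fin_cases i₂ <;> fin_cases i₃ <;> simp +decide
  · -- cancellation (4.3): the only non-trivial six-term sum is `1 + 1 − 1 − 1 = 0` at `{1,2,3} × (0,0,1)`
    intro i₁ i₂ i₃ μ₁ μ₂ μ₃ hμ
    rw [mem_shiftSet_iff] at hμ
    simp only [Prod.mk.injEq] at hμ
    rcases hμ with ⟨rfl, rfl, rfl⟩ | ⟨rfl, rfl, rfl⟩ | ⟨rfl, rfl, rfl⟩ | ⟨rfl, rfl, rfl⟩ <;>
      fin_cases i₁ <;> fin_cases i₂ <;> fin_cases i₃ <;> simp +decide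
  · -- comparability at `R = 1`: every constant is `0`, `1` or `−1`
    intro i₁ i₂ i₃ μ _
    rw [inv_one]
    by_cases hA : i₃ = 3 ∧ ((i₁ = 1 ∧ i₂ = 2) ∨ (i₁ = 2 ∧ i₂ = 1)) ∧ μ = ((0 : ℤ), (0 : ℤ), (1 : ℤ))
    · simp +decide [hA]
    · by_cases hB : i₁ = 3 ∧ i₂ = 1 ∧ i₃ = 2 ∧ μ = ((1 : ℤ), (0 : ℤ), (0 : ℤ))
      · simp +decide [hB]
      · by_cases hC : i₁ = 1 ∧ i₂ = 3 ∧ i₃ = 2 ∧ μ = ((0 : ℤ), (1 : ℤ), (0 : ℤ))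
        · simp +decide [hC]
        · simp +decide [hA, hB, hC]
  · simp +decide

end Summit.NavierStokesRegularity.NavierStokesRegularity.Theorems.NoSurvivingEternalViscBddOne.SubDyadicSpread

end
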